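import Mathlib
import Literature.RingTheory.MvPowerSeries.MaximalIdealPow
import Literature.AlgebraicGeometry.Resolution.CompleteFiniteness
import Summits.ResolutionOfSingularities.ResolutionOfSingularities.Theorems.WeightedInvariantLocalWeightedDropTOT2PlaneHasse
import Summits.ResolutionOfSingularities.ResolutionOfSingularities.Theorems.WeightedInvariantLocalWeightedDropTOT2BranchValuation

/-!
# TOT2-LINE (P3) brick B5-D3, part 2/3: EVERY SERIES IS A PLANE POLYNOMIAL IN `y` MODULO THE MONIC GERM (complete Nakayama)

Sub-problem `ResolutionOfSingularities`, ENGINE crux `stmt-ResolutionOfSingularities-8899` (`LocalWeightedDrop`), skeleton v35 (2e806da509994632),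
registered stub `stub_conflictBudget` (P3); dictionary brick B5-D3 `pairVal_lt_top` (split v1.1 of res-L1-w43-stub-2 g6, re-typed by res-L1-w43-plan-1
RULING (D3-retype) 2026-08-27T20:24:41Z; this hand res-L1-w43-stub-1 g7).  [OURS · L1 W4.3 · chain w43.  Engine bookkeeping: nothing here is a
statement of any manuscript; AI-produced, gate-checked, weaker than expert review.  «[OURS · L1 W4.3] replaces the role of nothing printed; NOT a
statement of the manuscript.»]

For every proper ideal `I` of `R₃ = k⟦u₁,u₂,y⟧` containing the monic germ `F = y^d + Σ A_j(u) y^j`: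
* `maximalIdeal_pow_le_span_sup`: the jets `𝔪^N ⊆ (u₁, u₂) + (y^N)` (tree `maximalIdeal_pow_eq_span_monomial`);
* `exists_X_pow_mem_sup`: `y^m ∈ I + (u₁, u₂)R₃` for some `m ≤ d` (`F(0,0,Y) = Y^m · unit`, `Polynomial.rootMultiplicity` at `0`);
* `exists_sum_eq_mk`: **`R₃ ⧸ I = Σ_{i<d} k⟦u₁,u₂⟧ · ȳ^i`** — complete Nakayama (`Matsumura1987_8_4_finset`: `k⟦u₁,u₂⟧` complete, `R₃ ⧸ I`
  `𝔪_{R₂}`-adically separated, and the classes modulo `(u₁,u₂)` are spanned by `ȳ^i`, `i < m`) — the finiteness half of Weierstrass division,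
  with no uniqueness needed;
* `exists_polynomial_sub_mem`: every `x ∈ R₃` is `≡ g(y) (mod I)` for a plane polynomial `g ∈ k⟦u₁,u₂⟧[Y]` of degree `< d`;
* `isIntegral_mk_comp_toThree`: `k⟦u₁,u₂⟧ → R₃ ⧸ I` is integral.
-/

set_option linter.dupNamespace false -- mandated namespace of this single-conjunct summit

noncomputable section

namespace Summit.ResolutionOfSingularities.ResolutionOfSingularities.Theorems

namespace TOT2Branch

open MvPowerSeries IsLocalRing

variable {k : Type} [Field k]

/-! ## §3 Reduction modulo the monic germ to polynomials in `y` over the plane (complete Nakayama) -/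

/-- `𝔪^N ⊆ (u₁, u₂) + (y^N)`. -/
theorem maximalIdeal_pow_le_span_sup (N : ℕ) :
    maximalIdeal (MvPowerSeries (Fin 3) k) ^ N ≤
      Ideal.span {(X 0 : MvPowerSeries (Fin 3) k), X 1} ⊔ Ideal.span {(X (Fin.last 2) : MvPowerSeries (Fin 3) k) ^ N} := by
  classical
  rw [Literature.RingTheory.MvPowerSeries.Jets.maximalIdeal_pow_eq_span_monomial, Ideal.span_le]
  rintro _ ⟨e, he, rfl⟩
  change e.degree = N at he
  dsimp only
  have hX : ∀ i : Fin 3, e i ≠ 0 → (X i : MvPowerSeries (Fin 3) k) ∣ monomial e (1 : k) := fun i hi =>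
    X_dvd_iff.mpr fun m hm => by rw [coeff_monomial, if_neg]; rintro rfl; exact hi hm
  by_cases h0 : e 0 ≠ 0
  · obtain ⟨t, ht⟩ := hX 0 h0
    rw [ht]
    exact Ideal.mem_sup_left (Ideal.mul_mem_right _ _ (Ideal.subset_span (by simp)))
  by_cases h1 : e 1 ≠ 0
  · obtain ⟨t, ht⟩ := hX 1 h1
    rw [ht]
    exact Ideal.mem_sup_left (Ideal.mul_mem_right _ _ (Ideal.subset_span (by simp)))
  push Not at h0 h1
  have he' : e = Finsupp.single (Fin.last 2) N := by
    have hsum : e.degree = e 0 + e 1 + e 2 := by rw [Finsupp.degree_eq_sum, Fin.sum_univ_three]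
    rw [Finsupp.eq_single_iff]
    refine ⟨fun i hi => ?_, ?_⟩
    · rw [Finset.mem_singleton]
      rw [Finsupp.mem_support_iff] at hi
      fin_cases i
      · exact absurd h0 hi
      · exact absurd h1 hi
      · rfl
    · change e 2 = N
      omega
  rw [he', ← X_pow_eq]
  exact Ideal.mem_sup_right (Ideal.subset_span rfl)

/-- `toThree` maps the maximal ideal of the plane into the ideal `(u₁, u₂)` of `R₃`, inside the maximal ideal. -/
theorem map_toThree_maximalIdeal_le :
    (maximalIdeal (MvPowerSeries (Fin 2) k)).map (toThree (k := k) : MvPowerSeries (Fin 2) k →+* MvPowerSeries (Fin 3) k) ≤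
      maximalIdeal (MvPowerSeries (Fin 3) k) := by
  rw [Ideal.map_le_iff_le_comap]
  intro g hg
  rw [Ideal.mem_comap, Literature.RingTheory.MvPowerSeries.Jets.mem_maximalIdeal_iff_constantCoeff_eq_zero, RingHom.coe_coe]
  change constantCoeff (rename (Fin.succAboveEmb (Fin.last 2)) g) = 0
  rw [constantCoeff_rename]
  exact Literature.RingTheory.MvPowerSeries.Jets.mem_maximalIdeal_iff_constantCoeff_eq_zero.mp hg

/-- `(u₁, u₂) ⊆ toThree(𝔪_{R₂}) R₃`. -/
theorem span_X_le_map_toThree_maximalIdeal :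
    Ideal.span {(X 0 : MvPowerSeries (Fin 3) k), X 1} ≤
      (maximalIdeal (MvPowerSeries (Fin 2) k)).map (toThree (k := k) : MvPowerSeries (Fin 2) k →+* MvPowerSeries (Fin 3) k) := by
  rw [Ideal.span_le]
  have h : ∀ i : Fin 2, (X (Fin.castSucc i) : MvPowerSeries (Fin 3) k) ∈
      (maximalIdeal (MvPowerSeries (Fin 2) k)).map (toThree (k := k) : MvPowerSeries (Fin 2) k →+* MvPowerSeries (Fin 3) k) := fun i => by
    rw [← toThree_X i]
    exact Ideal.mem_map_of_mem _ (Literature.AlgebraicGeometry.Resolution.X_mem_maximalIdeal k (Fin 2) i)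
  rintro x hx
  simp only [Set.mem_insert_iff, Set.mem_singleton_iff] at hx
  rcases hx with rfl | rfl
  · exact h 0
  · exact h 1

/-- A power `y^m`, `m ≤ d`, lies in `I + toThree(𝔪_{R₂}) R₃` whenever the monic germ lies in `I` (the `y`-order of `F(0,0,y)` is `≤ d`). -/
theorem exists_X_pow_mem_sup {d : ℕ} (A : Fin d → MvPowerSeries (Fin 2) k) {I : Ideal (MvPowerSeries (Fin 3) k)}
    (hF : NCPoly.monicGerm d A ∈ I) :
    ∃ m ≤ d, (X (Fin.last 2) : MvPowerSeries (Fin 3) k) ^ m ∈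
      I ⊔ (maximalIdeal (MvPowerSeries (Fin 2) k)).map (toThree (k := k) : MvPowerSeries (Fin 2) k →+* MvPowerSeries (Fin 3) k) := by
  -- the constant-coefficient polynomial `f₀' = Y^d + Σ A_j(0) Y^j ∈ k[Y]` and `f₀ = f₀'(y)`
  set f₀' : Polynomial k := WildMonic.monicPoly d (fun j => constantCoeff (A j)) with hf₀'
  have hmonic : f₀'.Monic := monic_monicPoly d _
  have hne : f₀' ≠ 0 := hmonic.ne_zero
  have hdiff : NCPoly.monicGerm d A - f₀'.eval₂ (C : k →+* MvPowerSeries (Fin 3) k) (X (Fin.last 2)) ∈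
      (maximalIdeal (MvPowerSeries (Fin 2) k)).map (toThree (k := k) : MvPowerSeries (Fin 2) k →+* MvPowerSeries (Fin 3) k) := by
    rw [monicGerm_eq_eval₂]
    simp only [hf₀', WildMonic.monicPoly, Polynomial.eval₂_add, Polynomial.eval₂_X_pow, Polynomial.eval₂_finsetSum,
      Polynomial.eval₂_mul, Polynomial.eval₂_C, RingHom.coe_coe]
    rw [add_sub_add_left_eq_sub, ← Finset.sum_sub_distrib]
    refine Ideal.sum_mem _ fun j _ => ?_
    rw [← sub_mul]
    refine Ideal.mul_mem_right _ _ ?_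
    have hC : (C (constantCoeff (A j)) : MvPowerSeries (Fin 3) k) = toThree (C (constantCoeff (A j)) : MvPowerSeries (Fin 2) k) := by
      change _ = rename _ _; rw [rename_C]
    rw [hC, ← map_sub]
    refine Ideal.mem_map_of_mem _ ?_
    rw [Literature.RingTheory.MvPowerSeries.Jets.mem_maximalIdeal_iff_constantCoeff_eq_zero, map_sub, constantCoeff_C, sub_self]
  -- `f₀ ∈ I + toThree(𝔪) R₃`
  have hf₀ : f₀'.eval₂ (C : k →+* MvPowerSeries (Fin 3) k) (X (Fin.last 2)) ∈
      I ⊔ (maximalIdeal (MvPowerSeries (Fin 2) k)).map (toThree (k := k) : MvPowerSeries (Fin 2) k →+* MvPowerSeries (Fin 3) k) := by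
    have h := Ideal.sub_mem _ (Ideal.mem_sup_left hF) (Ideal.mem_sup_right hdiff)
    rwa [sub_sub_cancel] at h
  -- `f₀' = Y^m · q'` with `q'(0) ≠ 0`
  obtain ⟨q', hfq, hndvd⟩ := Polynomial.exists_eq_pow_rootMultiplicity_mul_and_not_dvd f₀' hne 0
  rw [map_zero, sub_zero] at hfq hndvd
  set m := f₀'.rootMultiplicity 0 with hm
  refine ⟨m, ?_, ?_⟩
  · have h1 : (Polynomial.X : Polynomial k) ^ m ∣ f₀' := ⟨q', hfq⟩
    have h2 := Polynomial.natDegree_le_of_dvd h1 hne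
    rwa [Polynomial.natDegree_X_pow, hf₀', WildMonic.natDegree_monicPoly] at h2
  · have hq0 : q'.coeff 0 ≠ 0 := by rwa [Polynomial.X_dvd_iff] at hndvd
    have hunit : IsUnit (q'.eval₂ (C : k →+* MvPowerSeries (Fin 3) k) (X (Fin.last 2))) := by
      rw [isUnit_iff_constantCoeff]
      have hc : constantCoeff (q'.eval₂ (C : k →+* MvPowerSeries (Fin 3) k) (X (Fin.last 2))) = q'.coeff 0 := by
        rw [Polynomial.hom_eval₂, constantCoeff_X, Polynomial.eval₂_at_zero]
        change (constantCoeff.comp C) (q'.coeff 0) = q'.coeff 0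
        rw [RingHom.comp_apply, constantCoeff_C]
      rw [hc]
      exact isUnit_iff_ne_zero.mpr hq0
    obtain ⟨u, hu⟩ := hunit
    have hym : (X (Fin.last 2) : MvPowerSeries (Fin 3) k) ^ m =
        f₀'.eval₂ (C : k →+* MvPowerSeries (Fin 3) k) (X (Fin.last 2)) * ↑u⁻¹ := by
      rw [hfq, Polynomial.eval₂_mul, Polynomial.eval₂_X_pow, ← hu, mul_assoc, Units.mul_inv, mul_one]
    rw [hym]
    exact Ideal.mul_mem_right _ _ hf₀

/-- **`R₃ ⧸ I = Σ_{i<d} k⟦u₁,u₂⟧ · ȳ^i`** for every proper ideal `I` containing the monic germ (complete Nakayama, Matsumura 8.4: `R₂ = k⟦u₁,u₂⟧` is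
complete, `R₃ ⧸ I` is `𝔪_{R₂}`-adically separated, and modulo `(u₁, u₂)` the class of every series is a polynomial in `y` of degree `< m ≤ d`
because `y^m ∈ I + (u₁,u₂)`). -/
theorem exists_sum_eq_mk {d : ℕ} (A : Fin d → MvPowerSeries (Fin 2) k) {I : Ideal (MvPowerSeries (Fin 3) k)} (hI : I ≠ ⊤)
    (hF : NCPoly.monicGerm d A ∈ I) (z : MvPowerSeries (Fin 3) k ⧸ I) :
    ∃ c : Fin d → MvPowerSeries (Fin 2) k, z = ∑ i : Fin d, Ideal.Quotient.mk I (toThree (c i) * X (Fin.last 2) ^ (i : ℕ)) := by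
  classical
  haveI : IsNoetherianRing (MvPowerSeries (Fin 3) k) := Literature.AlgebraicGeometry.Resolution.isNoetherianRing_mvPowerSeries k (Fin 3)
  haveI : IsNoetherianRing (MvPowerSeries (Fin 2) k) := Literature.AlgebraicGeometry.Resolution.isNoetherianRing_mvPowerSeries k (Fin 2)
  haveI : Nontrivial (MvPowerSeries (Fin 3) k ⧸ I) := Ideal.Quotient.nontrivial_iff.mpr hI
  haveI : IsLocalRing (MvPowerSeries (Fin 3) k ⧸ I) := IsLocalRing.of_surjective' (Ideal.Quotient.mk I) Ideal.Quotient.mk_surjective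
  haveI : IsAdicComplete (maximalIdeal (MvPowerSeries (Fin 3) k)) (MvPowerSeries (Fin 3) k) := isAdicComplete_maximalIdeal
  haveI : IsAdicComplete (maximalIdeal (MvPowerSeries (Fin 3) k ⧸ I)) (MvPowerSeries (Fin 3) k ⧸ I) :=
    Literature.AlgebraicGeometry.Resolution.isAdicComplete_quotient I
  haveI : IsAdicComplete (maximalIdeal (MvPowerSeries (Fin 2) k)) (MvPowerSeries (Fin 2) k) := by
    rw [Literature.AlgebraicGeometry.Resolution.maximalIdeal_mvPowerSeries_eq_span k (Fin 2)]
    infer_instance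
  set ψ : MvPowerSeries (Fin 2) k →+* MvPowerSeries (Fin 3) k ⧸ I :=
    (Ideal.Quotient.mk I).comp (toThree (k := k) : MvPowerSeries (Fin 2) k →+* MvPowerSeries (Fin 3) k) with hψ
  letI : Algebra (MvPowerSeries (Fin 2) k) (MvPowerSeries (Fin 3) k ⧸ I) := ψ.toAlgebra
  have halg : ∀ r, algebraMap (MvPowerSeries (Fin 2) k) (MvPowerSeries (Fin 3) k ⧸ I) r = Ideal.Quotient.mk I (toThree r) := fun _ => rfl
  -- the auxiliary ideal `J₃ = I + toThree(𝔪) R₃` and its image `𝔪_{R₂} · (R₃ ⧸ I)`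
  set J₃ : Ideal (MvPowerSeries (Fin 3) k) :=
    I ⊔ (maximalIdeal (MvPowerSeries (Fin 2) k)).map (toThree (k := k) : MvPowerSeries (Fin 2) k →+* MvPowerSeries (Fin 3) k) with hJ₃
  have hJ : ∀ r ∈ J₃, Ideal.Quotient.mk I r ∈
      ((maximalIdeal (MvPowerSeries (Fin 2) k)) • (⊤ : Submodule (MvPowerSeries (Fin 2) k) (MvPowerSeries (Fin 3) k ⧸ I))) := by
    intro r hr
    rw [Ideal.smul_top_eq_map, Submodule.restrictScalars_mem, RingHom.algebraMap_toAlgebra, ← Ideal.map_map]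
    obtain ⟨i, hi, w, hw, rfl⟩ := Submodule.mem_sup.mp hr
    rw [map_add, Ideal.Quotient.eq_zero_iff_mem.mpr hi, zero_add]
    exact Ideal.mem_map_of_mem _ hw
  obtain ⟨m, hmd, hym⟩ := exists_X_pow_mem_sup A hF
  have hpow : maximalIdeal (MvPowerSeries (Fin 3) k) ^ m ≤ J₃ :=
    (maximalIdeal_pow_le_span_sup m).trans (sup_le (span_X_le_map_toThree_maximalIdeal.trans le_sup_right)
      ((Ideal.span_singleton_le_iff_mem _).mpr hym))
  -- generators
  let T : Finset (MvPowerSeries (Fin 3) k ⧸ I) := (Finset.range d).image fun i => Ideal.Quotient.mk I (X (Fin.last 2) ^ i)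
  have hsup : Submodule.span (MvPowerSeries (Fin 2) k) (T : Set (MvPowerSeries (Fin 3) k ⧸ I)) ⊔
      ((maximalIdeal (MvPowerSeries (Fin 2) k)) • (⊤ : Submodule (MvPowerSeries (Fin 2) k) (MvPowerSeries (Fin 3) k ⧸ I))) = ⊤ := by
    refine Submodule.eq_top_iff'.mpr fun z => ?_
    obtain ⟨f, rfl⟩ := Ideal.Quotient.mk_surjective z
    have hsplit : f = ((truncTotal m f : MvPolynomial (Fin 3) k) : MvPowerSeries (Fin 3) k) +
        (f - (truncTotal m f : MvPolynomial (Fin 3) k)) := by ring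
    rw [hsplit, map_add]
    refine Submodule.add_mem _ ?_
      (Submodule.mem_sup_right (hJ _ (hpow (Literature.RingTheory.MvPowerSeries.Jets.sub_coe_truncTotal_mem_maximalIdeal_pow m f))))
    rw [(truncTotal m f).as_sum, ← MvPolynomial.coeToMvPowerSeries.ringHom_apply, map_sum, map_sum]
    refine Submodule.sum_mem _ fun e he => ?_
    have hedeg : e.degree < m := by
      by_contra hN'
      simp only [not_lt] at hN'
      exact (MvPolynomial.mem_support_iff.1 he) (coeff_truncTotal_eq_zero _ hN')
    rw [MvPolynomial.coeToMvPowerSeries.ringHom_apply, MvPolynomial.coe_monomial]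
    have hX : ∀ i : Fin 3, e i ≠ 0 → (X i : MvPowerSeries (Fin 3) k) ∣ monomial e ((truncTotal m f).coeff e) := fun i hi =>
      X_dvd_iff.mpr fun m' hm' => by rw [coeff_monomial, if_neg]; rintro rfl; exact hi hm'
    have hcase : ∀ i : Fin 2, e (Fin.castSucc i) ≠ 0 →
        Ideal.Quotient.mk I (monomial e ((truncTotal m f).coeff e)) ∈
          Submodule.span (MvPowerSeries (Fin 2) k) (T : Set (MvPowerSeries (Fin 3) k ⧸ I)) ⊔
            ((maximalIdeal (MvPowerSeries (Fin 2) k)) • (⊤ : Submodule (MvPowerSeries (Fin 2) k) (MvPowerSeries (Fin 3) k ⧸ I))) := by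
      intro i hi
      obtain ⟨t, ht⟩ := hX (Fin.castSucc i) hi
      refine Submodule.mem_sup_right (hJ _ ?_)
      rw [ht, hJ₃]
      refine Ideal.mem_sup_right (Ideal.mul_mem_right _ _ ?_)
      rw [← toThree_X i]
      exact Ideal.mem_map_of_mem _ (Literature.AlgebraicGeometry.Resolution.X_mem_maximalIdeal k (Fin 2) i)
    by_cases h0 : e 0 ≠ 0
    · exact hcase 0 h0
    by_cases h1 : e 1 ≠ 0
    · exact hcase 1 h1
    push Not at h0 h1
    -- a pure power of `y` of exponent `< m ≤ d`
    have he' : e = Finsupp.single (Fin.last 2) (e (Fin.last 2)) := by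
      rw [Finsupp.eq_single_iff]
      refine ⟨fun i hi => ?_, rfl⟩
      rw [Finset.mem_singleton]
      rw [Finsupp.mem_support_iff] at hi
      fin_cases i
      · exact absurd h0 hi
      · exact absurd h1 hi
      · rfl
    have hlt : e (Fin.last 2) < d := by
      have hsum : e.degree = e 0 + e 1 + e 2 := by rw [Finsupp.degree_eq_sum, Fin.sum_univ_three]
      change e 2 < d
      omega
    have hmono : monomial e ((truncTotal m f).coeff e) =
        toThree (C ((truncTotal m f).coeff e) : MvPowerSeries (Fin 2) k) * (X (Fin.last 2) : MvPowerSeries (Fin 3) k) ^ (e (Fin.last 2)) := by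
      have hC : toThree (C ((truncTotal m f).coeff e) : MvPowerSeries (Fin 2) k) = (C ((truncTotal m f).coeff e) : MvPowerSeries (Fin 3) k) := by
        change rename _ _ = _; rw [rename_C]
      rw [hC, X_pow_eq, ← he']
      ext β
      rw [coeff_C_mul, coeff_monomial, coeff_monomial]
      split_ifs <;> simp
    rw [hmono, map_mul, ← halg, ← Algebra.smul_def]
    refine Submodule.mem_sup_left (Submodule.smul_mem _ _ (Submodule.subset_span ?_))
    rw [Finset.mem_coe]
    exact Finset.mem_image.mpr ⟨e (Fin.last 2), Finset.mem_range.mpr hlt, rfl⟩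
  -- separatedness and Nakayama
  have hloc : (maximalIdeal (MvPowerSeries (Fin 2) k)).map (algebraMap (MvPowerSeries (Fin 2) k) (MvPowerSeries (Fin 3) k ⧸ I)) ≤
      maximalIdeal (MvPowerSeries (Fin 3) k ⧸ I) := by
    rw [RingHom.algebraMap_toAlgebra, ← Ideal.map_map,
      ← IsLocalRing.map_maximalIdeal_of_surjective (Ideal.Quotient.mk I) Ideal.Quotient.mk_surjective]
    exact Ideal.map_mono map_toThree_maximalIdeal_le
  haveI : IsHausdorff (maximalIdeal (MvPowerSeries (Fin 2) k)) (MvPowerSeries (Fin 3) k ⧸ I) := by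
    refine ⟨fun x hx => IsHausdorff.haus
      ‹IsAdicComplete (maximalIdeal (MvPowerSeries (Fin 3) k ⧸ I)) (MvPowerSeries (Fin 3) k ⧸ I)›.toIsHausdorff x fun n => ?_⟩
    have hxn := hx n
    rw [SModEq.zero] at hxn ⊢
    rw [Ideal.smul_top_eq_map, Submodule.restrictScalars_mem, Ideal.map_pow] at hxn
    rw [smul_eq_mul, Ideal.mul_top]
    exact Ideal.pow_right_mono hloc n hxn
  have htop := Literature.AlgebraicGeometry.Resolution.Matsumura1987_8_4_finset (maximalIdeal (MvPowerSeries (Fin 2) k)) T hsup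
  -- read off the coefficients
  let S : Submodule (MvPowerSeries (Fin 2) k) (MvPowerSeries (Fin 3) k ⧸ I) :=
    { carrier := {z | ∃ c : Fin d → MvPowerSeries (Fin 2) k, z = ∑ i : Fin d, Ideal.Quotient.mk I (toThree (c i) * X (Fin.last 2) ^ (i : ℕ))}
      zero_mem' := ⟨0, by simp⟩
      add_mem' := by
        rintro _ _ ⟨c₁, rfl⟩ ⟨c₂, rfl⟩
        refine ⟨c₁ + c₂, ?_⟩
        rw [← Finset.sum_add_distrib]
        exact Finset.sum_congr rfl fun i _ => by rw [Pi.add_apply, map_add, add_mul, map_add]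
      smul_mem' := by
        rintro r _ ⟨c, rfl⟩
        refine ⟨fun i => r * c i, ?_⟩
        rw [Finset.smul_sum]
        exact Finset.sum_congr rfl fun i _ => by simp only [Algebra.smul_def, halg, map_mul, mul_assoc] }
  have hTS : (T : Set (MvPowerSeries (Fin 3) k ⧸ I)) ⊆ S := fun t ht => by
    rw [Finset.mem_coe] at ht
    obtain ⟨i, hi, rfl⟩ := Finset.mem_image.mp ht
    rw [Finset.mem_range] at hi
    refine ⟨Pi.single (⟨i, hi⟩ : Fin d) 1, ?_⟩
    rw [Finset.sum_eq_single (⟨i, hi⟩ : Fin d) (fun j _ hj => by rw [Pi.single_eq_of_ne hj, map_zero, zero_mul, map_zero])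
      (fun h => absurd (Finset.mem_univ _) h), Pi.single_eq_same, map_one, one_mul]
  have hz : z ∈ S := (Submodule.span_le.mpr hTS) (by rw [htop]; exact Submodule.mem_top)
  exact hz

/-- **EVERY SERIES IS A POLYNOMIAL IN `y` OVER THE PLANE MODULO THE MONIC GERM**: for a proper ideal `I ∋ F` and `x ∈ R₃` there is `g ∈ k⟦u₁,u₂⟧[Y]`
of degree `< d` with `x ≡ g(y) (mod I)`. -/
theorem exists_polynomial_sub_mem {d : ℕ} (A : Fin d → MvPowerSeries (Fin 2) k) {I : Ideal (MvPowerSeries (Fin 3) k)} (hI : I ≠ ⊤)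
    (hF : NCPoly.monicGerm d A ∈ I) (x : MvPowerSeries (Fin 3) k) :
    ∃ g : Polynomial (MvPowerSeries (Fin 2) k), g.degree < d ∧
      x - g.eval₂ (toThree (k := k) : MvPowerSeries (Fin 2) k →+* MvPowerSeries (Fin 3) k) (X (Fin.last 2)) ∈ I := by
  obtain ⟨c, hc⟩ := exists_sum_eq_mk A hI hF (Ideal.Quotient.mk I x)
  refine ⟨∑ i : Fin d, Polynomial.C (c i) * Polynomial.X ^ (i : ℕ), Polynomial.degree_sum_fin_lt c, ?_⟩
  rw [← Ideal.Quotient.eq, hc, Polynomial.eval₂_finsetSum, map_sum]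
  refine Finset.sum_congr rfl fun i _ => ?_
  rw [Polynomial.eval₂_mul, Polynomial.eval₂_C, Polynomial.eval₂_X_pow, RingHom.coe_coe]

/-- **`k⟦u₁,u₂⟧ → R₃ ⧸ I` IS INTEGRAL** for a proper ideal `I` containing the monic germ. -/
theorem isIntegral_mk_comp_toThree {d : ℕ} (A : Fin d → MvPowerSeries (Fin 2) k) {I : Ideal (MvPowerSeries (Fin 3) k)} (hI : I ≠ ⊤)
    (hF : NCPoly.monicGerm d A ∈ I) :
    ((Ideal.Quotient.mk I).comp (toThree (k := k) : MvPowerSeries (Fin 2) k →+* MvPowerSeries (Fin 3) k)).IsIntegral := by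
  classical
  letI : Algebra (MvPowerSeries (Fin 2) k) (MvPowerSeries (Fin 3) k ⧸ I) :=
    ((Ideal.Quotient.mk I).comp (toThree (k := k) : MvPowerSeries (Fin 2) k →+* MvPowerSeries (Fin 3) k)).toAlgebra
  have halg : ∀ r, algebraMap (MvPowerSeries (Fin 2) k) (MvPowerSeries (Fin 3) k ⧸ I) r = Ideal.Quotient.mk I (toThree r) := fun _ => rfl
  let T : Finset (MvPowerSeries (Fin 3) k ⧸ I) := (Finset.range d).image fun i => Ideal.Quotient.mk I (X (Fin.last 2) ^ i)
  haveI : Module.Finite (MvPowerSeries (Fin 2) k) (MvPowerSeries (Fin 3) k ⧸ I) := by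
    refine ⟨⟨T, Submodule.eq_top_iff'.mpr fun z => ?_⟩⟩
    obtain ⟨c, rfl⟩ := exists_sum_eq_mk A hI hF z
    refine Submodule.sum_mem _ fun i _ => ?_
    rw [map_mul, ← halg, ← Algebra.smul_def]
    refine Submodule.smul_mem _ _ (Submodule.subset_span ?_)
    rw [Finset.mem_coe]
    exact Finset.mem_image.mpr ⟨(i : ℕ), Finset.mem_range.mpr i.2, rfl⟩
  exact fun z => Algebra.IsIntegral.isIntegral (R := MvPowerSeries (Fin 2) k) z

end TOT2Branch

end Summit.ResolutionOfSingularities.ResolutionOfSingularities.Theorems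

end
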